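import Literature.NumberTheory.Irrationality.Hata1992.PeriodicStepFactor
import HarnessLib

/-!
# Truncated savings factors: only the windows `k₀ ≤ ⌊n/p⌋ ≤ K` (primes `p > n/(K+1)`), with rate `↑` the full `∫ φ dψ` as `K → ∞`

Topic `Literature/NumberTheory/Irrationality/Hata1992`. HONEST FRAMING (cell `pub-zeta5`): systematic search; no irrationality claim
unless certified. Nothing here concerns the arithmetic nature of any constant.

In print the savings factor runs over the primes `p > √(m₁ n)` only [cite: Zudilin2004, §8 (8.8) (`Φ_n = ∏_{√((η₀−2η₁)n) < p ≤ …} p^{ν_p}`);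
Hata1992, §2 p. 340 (`n > max{L, b(βλ)²}`)], because the valuation information `ν_p ≥ φ(n/p)` comes from `ord_p N! = ⌊N/p⌋`, valid for
`p² > N`. The restriction costs nothing at the level of rates. This file gives the form a user with valuation laws valid only for LARGE primes
(e.g. `p² > C·n`) consumes: truncate the product to the windows `k ≤ K` — all its primes exceed `n/(K+1)`, hence `p² > C n` as soon as
`n ≥ C (K+1)²` — and let `K → ∞` in the rate:

* `fracProdTrunc u v k₀ K n = ∏_{k₀ ≤ k ≤ K} fracWindow u v k n`, `stepFactorTrunc s u v c k₀ K n = ∏_i (fracProdTrunc (u i) (v i) k₀ K n)^{c i}`;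
* `lt_of_mem_fracWindow` — a prime of the `k`-th window with `k ≤ K` satisfies `n < (K+1)·p`; `sq_gt_of_mem_fracWindow` — hence
  `C·n < p²` once `C·(K+1)² ≤ n`;
* `padicValNat_stepFactorTrunc` — `v_p = [k₀ ≤ ⌊n/p⌋ ≤ K] · φ({n/p})`; `stepFactorTrunc_dvd_of_le_padicValNat` — divisibility from
  valuation bounds required ONLY at the primes of the truncated windows;
* `tendsto_log_stepFactorTrunc_div` — rate `Σ_i c_i S_K(u_i,v_i)`, `S_K = Σ_{k₀ ≤ k ≤ K} (1/(k+u) − 1/(k+v))`;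
* **`exists_trunc_eventually_exp_le`** — for every `ε > 0` there is `K` with `e^{(Σ_i c_i S(u_i,v_i,k₀) − ε) n} ≤ stepFactorTrunc … K n`
  for all large `n` (`S = fracRate = lim S_K`, `= Re(ψ(k₀+v) − ψ(k₀+u))` by `fracRate_eq_digamma`).

## References
* [Zudilin2004] W. Zudilin, J. Théor. Nombres Bordeaux 16 (2004) 251–291, §8 (8.8)–(8.9), Lemma 11.
* [Hata1992] M. Hata, Acta Arith. 60 (1992) 335–347, §2 pp. 340–341.
-/

noncomputable section

open Finset Filter Real
open scoped Topology

namespace Literature.NumberTheory.Irrationality.Hata1992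

variable {u v : ℝ}

/-! ### Truncated products -/

/-- The windows `k₀ ≤ k ≤ K` only: `∏_{k₀ ≤ k ≤ K} ∏_{⌊n/p⌋ = k, {n/p} ∈ [u,v)} p`. [cite: Zudilin2004, §8 (8.8); Hata1992, §2 p. 340] -/
def fracProdTrunc (u v : ℝ) (k₀ K n : ℕ) : ℕ := ∏ k ∈ Ico k₀ (K + 1), fracWindow u v k n

/-- The truncated savings factor of a step function `φ = Σ c_i 1_{[u_i,v_i)}`. [cite: Zudilin2004, §8 (8.8)] -/
def stepFactorTrunc {ι : Type*} (s : Finset ι) (u v : ι → ℝ) (c : ι → ℕ) (k₀ K n : ℕ) : ℕ :=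
  ∏ i ∈ s, fracProdTrunc (u i) (v i) k₀ K n ^ c i

/-- Positivity. [cite: Zudilin2004, §8 (8.8)] -/
theorem fracProdTrunc_pos (u v : ℝ) (k₀ K n : ℕ) : 0 < fracProdTrunc u v k₀ K n :=
  prod_pos fun k _ => fracWindow_pos u v k n

/-- Positivity. [cite: Zudilin2004, §8 (8.8)] -/
theorem stepFactorTrunc_pos {ι : Type*} (s : Finset ι) (u v : ι → ℝ) (c : ι → ℕ) (k₀ K n : ℕ) :
    0 < stepFactorTrunc s u v c k₀ K n :=
  prod_pos fun _ _ => pow_pos (fracProdTrunc_pos _ _ _ _ _) _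

/-! ### The primes of the truncated windows are large -/

/-- A prime of the `k`-th window with `k ≤ K` satisfies `n < (K+1)·p` (`0 < u < v ≤ 1`). [cite: Hata1992, §2 p. 340] -/
theorem lt_of_mem_fracWindow (hu : 0 < u) (huv : u < v) (hv : v ≤ 1) {k K n p : ℕ} (hk : k ≤ K)
    (hp : p ∈ windowPrimes (1 / ((k : ℝ) + v)) (1 / ((k : ℝ) + u)) n) : (n : ℝ) < ((K : ℝ) + 1) * p := by
  obtain ⟨hpr, -, h2⟩ := (mem_fracWindowPrimes_iff hu huv).1 hp
  have hp0 : (0 : ℝ) < p := by exact_mod_cast hpr.pos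
  rw [div_lt_iff₀ hp0] at h2
  have hkK : (k : ℝ) ≤ K := by exact_mod_cast hk
  nlinarith

/-- Hence `C·n < p²` for every prime of the truncated windows as soon as `C (K+1)² ≤ n` (`C ≥ 0`).
[cite: Zudilin2004, §8 (8.8) (the range `p > √((η₀−2η₁)n)`); Hata1992, §2 p. 340 (`n > b(βλ)²`)] -/
theorem sq_gt_of_mem_fracWindow (hu : 0 < u) (huv : u < v) (hv : v ≤ 1) {C : ℝ} (hC : 0 ≤ C) {k K n p : ℕ} (hk : k ≤ K)
    (hn : C * ((K : ℝ) + 1) ^ 2 ≤ n) (hp : p ∈ windowPrimes (1 / ((k : ℝ) + v)) (1 / ((k : ℝ) + u)) n) :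
    C * n < (p : ℝ) ^ 2 := by
  have h := lt_of_mem_fracWindow hu huv hv hk hp
  have hp0 : (0 : ℝ) < p := by exact_mod_cast (prime_of_mem_windowPrimes hp).pos
  have hK : (0 : ℝ) < (K : ℝ) + 1 := by positivity
  -- `n < (K+1) p` and `C (K+1)² ≤ n` give `C (K+1) < p`... combine: `C n < C (K+1) p ≤ p · p`? use `n ≥ C(K+1)²`:
  -- from `n < (K+1)p`: `(K+1) p > n ≥ C (K+1)²` ⇒ `p > C (K+1)` ⇒ `p² > C (K+1) p > C n`.
  have h1 : C * ((K : ℝ) + 1) < p := by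
    by_contra hcon
    have hcon' : (p : ℝ) ≤ C * ((K : ℝ) + 1) := not_lt.mp hcon
    have : ((K : ℝ) + 1) * p ≤ ((K : ℝ) + 1) * (C * ((K : ℝ) + 1)) := by gcongr
    nlinarith
  rcases hC.eq_or_lt with rfl | hC'
  · simpa using pow_pos hp0 2
  · nlinarith

/-! ### Valuations and divisibility -/

/-- `v_p(fracProdTrunc) = [k₀ ≤ ⌊n/p⌋ ≤ K] · [u ≤ {n/p} < v]` for a prime `p`. [cite: Zudilin2004, §8 (8.8)–(8.9)] -/
theorem padicValNat_fracProdTrunc (hu : 0 < u) (huv : u < v) (hv : v ≤ 1) {k₀ K n p : ℕ} (hp : p.Prime) :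
    padicValNat p (fracProdTrunc u v k₀ K n) =
      if (k₀ ≤ ⌊(n : ℝ) / p⌋₊ ∧ ⌊(n : ℝ) / p⌋₊ ≤ K) ∧ u ≤ Int.fract ((n : ℝ) / p) ∧ Int.fract ((n : ℝ) / p) < v
      then 1 else 0 := by
  classical
  unfold fracProdTrunc
  rw [← Nat.factorization_def _ hp, Nat.factorization_prod fun k _ => (fracWindow_pos u v k n).ne',
    Finset.sum_apply']
  simp_rw [Nat.factorization_def _ hp]
  have hterm : ∀ k : ℕ, padicValNat p (fracWindow u v k n) =
      if ⌊(n : ℝ) / p⌋₊ = k ∧ u ≤ Int.fract ((n : ℝ) / p) ∧ Int.fract ((n : ℝ) / p) < v then 1 else 0 := by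
    intro k
    unfold fracWindow
    rw [padicValNat_windowProd hp]
    by_cases h : ⌊(n : ℝ) / p⌋₊ = k ∧ u ≤ Int.fract ((n : ℝ) / p) ∧ Int.fract ((n : ℝ) / p) < v
    · rw [if_pos h, if_pos ((mem_fracWindowPrimes_iff_fract hu huv hv).2 ⟨hp, h⟩)]
    · rw [if_neg h, if_neg (fun hm => h ((mem_fracWindowPrimes_iff_fract hu huv hv).1 hm).2)]
  simp_rw [hterm]
  by_cases hC : u ≤ Int.fract ((n : ℝ) / p) ∧ Int.fract ((n : ℝ) / p) < v
  · have : ∀ k : ℕ, (if ⌊(n : ℝ) / p⌋₊ = k ∧ u ≤ Int.fract ((n : ℝ) / p) ∧ Int.fract ((n : ℝ) / p) < v then 1 else 0)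
        = (if ⌊(n : ℝ) / p⌋₊ = k then 1 else 0) := fun k => by
      by_cases hk : ⌊(n : ℝ) / p⌋₊ = k <;> simp [hk, hC]
    simp_rw [this]
    rw [Finset.sum_ite_eq]
    by_cases hk0 : k₀ ≤ ⌊(n : ℝ) / p⌋₊ ∧ ⌊(n : ℝ) / p⌋₊ ≤ K
    · rw [if_pos (Finset.mem_Ico.2 ⟨hk0.1, Nat.lt_succ_of_le hk0.2⟩), if_pos ⟨hk0, hC⟩]
    · rw [if_neg (fun hm => hk0 ⟨(Finset.mem_Ico.1 hm).1, Nat.le_of_lt_succ (Finset.mem_Ico.1 hm).2⟩),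
        if_neg (fun h => hk0 h.1)]
  · have : ∀ k : ℕ, (if ⌊(n : ℝ) / p⌋₊ = k ∧ u ≤ Int.fract ((n : ℝ) / p) ∧ Int.fract ((n : ℝ) / p) < v then 1 else 0)
        = (0 : ℕ) := fun k => by rw [if_neg (fun h => hC h.2)]
    simp_rw [this]
    rw [Finset.sum_const_zero, if_neg (fun h => hC h.2)]

variable {ι : Type*} {s : Finset ι} {U V : ι → ℝ} {c : ι → ℕ}

/-- `v_p(stepFactorTrunc) = [k₀ ≤ ⌊n/p⌋ ≤ K] · φ({n/p})`. [cite: Zudilin2004, §8 (8.9)] -/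
theorem padicValNat_stepFactorTrunc (h : ∀ i ∈ s, 0 < U i ∧ U i < V i ∧ V i ≤ 1) {k₀ K n p : ℕ} (hp : p.Prime) :
    padicValNat p (stepFactorTrunc s U V c k₀ K n) =
      if k₀ ≤ ⌊(n : ℝ) / p⌋₊ ∧ ⌊(n : ℝ) / p⌋₊ ≤ K then stepFun s U V c (Int.fract ((n : ℝ) / p)) else 0 := by
  classical
  unfold stepFactorTrunc stepFun
  rw [← Nat.factorization_def _ hp,
    Nat.factorization_prod fun i _ => (pow_pos (fracProdTrunc_pos (U i) (V i) k₀ K n) _).ne', Finset.sum_apply']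
  simp_rw [Nat.factorization_pow, Finsupp.smul_apply, smul_eq_mul, Nat.factorization_def _ hp]
  by_cases hk0 : k₀ ≤ ⌊(n : ℝ) / p⌋₊ ∧ ⌊(n : ℝ) / p⌋₊ ≤ K
  · rw [if_pos hk0]
    refine sum_congr rfl fun i hi => ?_
    rw [padicValNat_fracProdTrunc (h i hi).1 (h i hi).2.1 (h i hi).2.2 hp]
    by_cases hC : U i ≤ Int.fract ((n : ℝ) / p) ∧ Int.fract ((n : ℝ) / p) < V i
    · rw [if_pos ⟨hk0, hC⟩, if_pos hC, mul_one]
    · rw [if_neg (fun h' => hC h'.2), if_neg hC, mul_zero]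
  · rw [if_neg hk0]
    refine sum_eq_zero fun i hi => ?_
    rw [padicValNat_fracProdTrunc (h i hi).1 (h i hi).2.1 (h i hi).2.2 hp, if_neg (fun h' => hk0 h'.1), mul_zero]

/-- Divisibility from valuation bounds AT THE LARGE PRIMES ONLY: if `φ({n/p}) ≤ v_p(m)` for every prime `p` with
`k₀ ≤ ⌊n/p⌋ ≤ K` (all of them satisfy `n < (K+1)p`), then the truncated factor divides `m`.
[cite: Zudilin2004, §8 (8.8)–(8.10); Hata1992, §2 p. 340] -/
theorem stepFactorTrunc_dvd_of_le_padicValNat (h : ∀ i ∈ s, 0 < U i ∧ U i < V i ∧ V i ≤ 1) {k₀ K n m : ℕ} (hm : m ≠ 0)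
    (hv : ∀ p : ℕ, p.Prime → k₀ ≤ ⌊(n : ℝ) / p⌋₊ → ⌊(n : ℝ) / p⌋₊ ≤ K →
      stepFun s U V c (Int.fract ((n : ℝ) / p)) ≤ padicValNat p m) :
    stepFactorTrunc s U V c k₀ K n ∣ m := by
  have h0 : stepFactorTrunc s U V c k₀ K n ≠ 0 := (stepFactorTrunc_pos s U V c k₀ K n).ne'
  rw [← Nat.factorization_le_iff_dvd h0 hm]
  intro p
  by_cases hp : p.Prime
  · rw [Nat.factorization_def _ hp, Nat.factorization_def _ hp, padicValNat_stepFactorTrunc h hp]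
    by_cases hk0 : k₀ ≤ ⌊(n : ℝ) / p⌋₊ ∧ ⌊(n : ℝ) / p⌋₊ ≤ K
    · rw [if_pos hk0]; exact hv p hp hk0.1 hk0.2
    · rw [if_neg hk0]; exact Nat.zero_le _
  · simp [Nat.factorization_eq_zero_of_not_prime _ hp]

/-- For a prime `p` of the truncated range (`⌊n/p⌋ ≤ K`), `n < (K+1)·p`. [cite: Hata1992, §2 p. 340] -/
theorem lt_of_floor_div_le {K n p : ℕ} (hp : p.Prime) (hK : ⌊(n : ℝ) / p⌋₊ ≤ K) : (n : ℝ) < ((K : ℝ) + 1) * p := by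
  have hp0 : (0 : ℝ) < p := by exact_mod_cast hp.pos
  have h := Nat.lt_floor_add_one ((n : ℝ) / p)
  have h' : (n : ℝ) / p < (K : ℝ) + 1 := by
    calc (n : ℝ) / p < ⌊(n : ℝ) / p⌋₊ + 1 := h
      _ ≤ (K : ℝ) + 1 := by exact_mod_cast Nat.add_le_add_right hK 1
  rwa [div_lt_iff₀ hp0] at h'

/-! ### Rates -/

/-- `log fracProdTrunc = Σ_{k₀ ≤ k ≤ K} log fracWindow`. [cite: Zudilin2004, Lemma 11] -/
theorem log_fracProdTrunc (u v : ℝ) (k₀ K n : ℕ) :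
    Real.log (fracProdTrunc u v k₀ K n : ℕ) = ∑ k ∈ Ico k₀ (K + 1), Real.log (fracWindow u v k n : ℕ) := by
  unfold fracProdTrunc
  rw [Nat.cast_prod, Real.log_prod]
  intro k _
  exact_mod_cast (fracWindow_pos u v k n).ne'

/-- The partial rate `S_K(u,v) = Σ_{k₀ ≤ k ≤ K} (1/(k+u) − 1/(k+v))`. [cite: Zudilin2004, Lemma 11] -/
def fracRateTrunc (u v : ℝ) (k₀ K : ℕ) : ℝ := ∑ k ∈ Ico k₀ (K + 1), (1 / ((k : ℝ) + u) - 1 / ((k : ℝ) + v))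

/-- `(log fracProdTrunc)/n → S_K`. [cite: Hata1992, §2 pp. 340–341] -/
theorem tendsto_log_fracProdTrunc_div (hu : 0 < u) (huv : u ≤ v) (k₀ K : ℕ) :
    Tendsto (fun n : ℕ => Real.log (fracProdTrunc u v k₀ K n : ℕ) / n) atTop (𝓝 (fracRateTrunc u v k₀ K)) := by
  refine (tendsto_head_div hu huv k₀ K).congr' (Eventually.of_forall fun n => ?_)
  beta_reduce
  rw [log_fracProdTrunc]

/-- `S_K → S` as `K → ∞`. [cite: Zudilin2004, Lemma 11] -/
theorem tendsto_fracRateTrunc (hu : 0 < u) (huv : u ≤ v) (k₀ : ℕ) :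
    Tendsto (fun K : ℕ => fracRateTrunc u v k₀ K) atTop (𝓝 (fracRate u v k₀)) := by
  set g : ℕ → ℝ := fun k => 1 / ((k : ℝ) + u) - 1 / ((k : ℝ) + v) with hg
  have hS := hasSum_fracRate hu (lt_of_lt_of_le hu huv) k₀
  have hP : Tendsto (fun m : ℕ => ∑ i ∈ range m, g (i + k₀)) atTop (𝓝 (fracRate u v k₀)) := hS.tendsto_sum_nat
  have hSK : ∀ K, fracRateTrunc u v k₀ K = ∑ i ∈ range (K + 1 - k₀), g (i + k₀) := by
    intro K; unfold fracRateTrunc; rw [sum_Ico_eq_sum_range]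
    exact sum_congr rfl fun i _ => by rw [Nat.add_comm i k₀]
  simp_rw [hSK]
  exact hP.comp (tendsto_atTop_atTop.2 fun m => ⟨m + k₀, fun K hK => by omega⟩)

/-- `log stepFactorTrunc = Σ_i c_i log fracProdTrunc_i`. [cite: Zudilin2004, Lemma 11] -/
theorem log_stepFactorTrunc (s : Finset ι) (U V : ι → ℝ) (c : ι → ℕ) (k₀ K n : ℕ) :
    Real.log (stepFactorTrunc s U V c k₀ K n : ℕ) =
      ∑ i ∈ s, (c i : ℝ) * Real.log (fracProdTrunc (U i) (V i) k₀ K n : ℕ) := by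
  unfold stepFactorTrunc
  rw [Nat.cast_prod, Real.log_prod]
  · refine sum_congr rfl fun i _ => ?_
    rw [Nat.cast_pow, Real.log_pow]
  · intro i _
    exact_mod_cast (pow_pos (fracProdTrunc_pos (U i) (V i) k₀ K n) _).ne'

/-- Rate of the truncated step factor: `(log Φ_n^{(K)})/n → Σ_i c_i S_K(u_i, v_i)`. [cite: Zudilin2004, Lemma 11; Hata1992, §2 (2.5)] -/
theorem tendsto_log_stepFactorTrunc_div (h : ∀ i ∈ s, 0 < U i ∧ U i < V i ∧ V i ≤ 1) (k₀ K : ℕ) :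
    Tendsto (fun n : ℕ => Real.log (stepFactorTrunc s U V c k₀ K n : ℕ) / n) atTop
      (𝓝 (∑ i ∈ s, (c i : ℝ) * fracRateTrunc (U i) (V i) k₀ K)) := by
  have hi : ∀ i ∈ s, Tendsto (fun n : ℕ => (c i : ℝ) * (Real.log (fracProdTrunc (U i) (V i) k₀ K n : ℕ) / n)) atTop
      (𝓝 ((c i : ℝ) * fracRateTrunc (U i) (V i) k₀ K)) :=
    fun i hi => (tendsto_log_fracProdTrunc_div (h i hi).1 (h i hi).2.1.le k₀ K).const_mul _
  refine (tendsto_finsetSum s hi).congr' (Eventually.of_forall fun n => ?_)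
  beta_reduce
  rw [log_stepFactorTrunc, sum_div]
  refine sum_congr rfl fun i _ => ?_
  ring

/-- **Truncation is free at the level of rates**: for every `ε > 0` there is `K` such that
`e^{(Σ_i c_i S(u_i,v_i,k₀) − ε) n} ≤ stepFactorTrunc s u v c k₀ K n` for all large `n` (and all primes involved satisfy `n < (K+1)p`).
[cite: Hata1992, §2 pp. 340–341 ("since `L` is arbitrary"); Zudilin2004, Lemma 11] -/
theorem exists_trunc_eventually_exp_le (h : ∀ i ∈ s, 0 < U i ∧ U i < V i ∧ V i ≤ 1) (k₀ : ℕ) {ε : ℝ} (hε : 0 < ε) :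
    ∃ K : ℕ, ∀ᶠ n : ℕ in atTop,
      Real.exp ((∑ i ∈ s, (c i : ℝ) * fracRate (U i) (V i) k₀ - ε) * n) ≤ (stepFactorTrunc s U V c k₀ K n : ℕ) := by
  -- `Σ c_i S_K(i) → Σ c_i S(i)` as `K → ∞`; pick `K` with the truncated rate `> Σ c_i S(i) − ε/2`
  have hK : Tendsto (fun K : ℕ => ∑ i ∈ s, (c i : ℝ) * fracRateTrunc (U i) (V i) k₀ K) atTop
      (𝓝 (∑ i ∈ s, (c i : ℝ) * fracRate (U i) (V i) k₀)) :=
    tendsto_finsetSum s fun i hi => (tendsto_fracRateTrunc (h i hi).1 (h i hi).2.1.le k₀).const_mul _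
  obtain ⟨K, hKε⟩ := (hK.eventually (eventually_gt_nhds (show ∑ i ∈ s, (c i : ℝ) * fracRate (U i) (V i) k₀ - ε / 2
      < ∑ i ∈ s, (c i : ℝ) * fracRate (U i) (V i) k₀ by linarith))).exists
  refine ⟨K, ?_⟩
  have h2 : ∀ᶠ n : ℕ in atTop, ∑ i ∈ s, (c i : ℝ) * fracRate (U i) (V i) k₀ - ε
      < Real.log (stepFactorTrunc s U V c k₀ K n : ℕ) / n :=
    (tendsto_log_stepFactorTrunc_div h k₀ K).eventually (eventually_gt_nhds (by linarith))
  filter_upwards [h2, eventually_gt_atTop 0] with n hn hn0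
  have hn' : (0 : ℝ) < n := by exact_mod_cast hn0
  have hpos : (0 : ℝ) < (stepFactorTrunc s U V c k₀ K n : ℕ) := by exact_mod_cast stepFactorTrunc_pos s U V c k₀ K n
  rw [lt_div_iff₀ hn'] at hn
  calc Real.exp ((∑ i ∈ s, (c i : ℝ) * fracRate (U i) (V i) k₀ - ε) * n)
      ≤ Real.exp (Real.log (stepFactorTrunc s U V c k₀ K n : ℕ)) := Real.exp_le_exp.mpr hn.le
    _ = (stepFactorTrunc s U V c k₀ K n : ℕ) := Real.exp_log hpos

end Literature.NumberTheory.Irrationality.Hata1992
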